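import Summits.QuantumAdvantage.QuantumAdvantage.Theorems.LinnikCubicClassGroupsDegreeOnePrimesEscapeFrobeniusWindowCore
import Summits.QuantumAdvantage.QuantumAdvantage.Theorems.LinnikCubicClassGroupsDegreeOnePrimesEscapeFrobeniusWindowBookkeeping
import Summits.QuantumAdvantage.QuantumAdvantage.Theorems.LinnikCubicClassGroupsDegreeOnePrimesEscapeDeuringSmoothedCore
import Summits.QuantumAdvantage.QuantumAdvantage.Theorems.LinnikCubicClassGroupsDegreeOnePrimesEscapeShortIntervalInputs
import HarnessLib

/-!
# The Deuring-twisted explicit formula of a cyclic `N|E` against a window weight: the dichotomy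

Topic `Summits/QuantumAdvantage/QuantumAdvantage/Theorems`, cell B2b-1 (linnik-cubic), PART A (gen 17); helper
toward the crux `DegreeOnePrimesEscape` (stmt-QuantumAdvantage-11543) of route `LinnikCubicClassGroups` — the
CHEBOTAREV DENSITY THEOREM IN SHORT INTERVALS for conjugacy classes, analytic step.  HONEST FRAMING: the value of
this file is a THEOREM (kernel-checked) — NOT summit progress.

`frobWindow_dichotomy`: for `n₀ > 1`, density constants `b, D, a`, a precision `κ > 0` and a collar ratio
`0 < ε₀ ≤ 1/4` there are `θ, a₁, c > 0` such that for every cyclic-type Hecke datum `(𝔣_j, χ_j, L_j)_{j<m}` of an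
extension `N|E` with `[N:ℚ] = n₀` (`ord_ρ ζ₁_N = ord_ρ ζ₁_E + Σ_{0<j<m} ord_ρ L_j`), the log-free density bound
for the class-group family of `N`, every `x ≥ Q^{a₁}` (`Q = |d_N| n₀^{n₀}`), every `0 < η ≤ log 2` with
`x^{−θ/8} ≤ 2η`, every window `log x ≤ lo < hi ≤ log x + η` and every `|c| ≤ 1`, with
`g = windowTest lo hi (ε₀η)` and `F` its Laplace transform:
(A) if `ζ₁_N` has no real zero in `(1 − c/(log|d_N| + log 4), 1)` then `‖Σ_{j<m} c^j K_j(g) − F(−1)‖ ≤ κ x η`;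
(B) if `β₁` is such a zero then for an index `j₀ < m` carrying `β₁` (`ord_{β₁} ζ₁_E = 1` if `j₀ = 0`, else
`ord_{β₁} L_{j₀} = 1`): `‖Σ_{j<m} c^j K_j(g) − F(−1) + c^{j₀} F(−β₁)‖ ≤ κ x η`.
Ingredients: `frobWindow_core` (Hoheisel's flat part at height `T₁ = X^θ`), the Landau–Page package of `N`
(`exists_exceptionalZero_const`: reality, uniqueness, simplicity of the exceptional zero), and the real-variable
bookkeeping `frobWindow_bookkeeping` with targets `κ₁ = κ/(9n₀)`, `κ₂ = κ/(2n₀)`.  No Deuring–Heilbronn is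
used: in case (B) with `c^{j₀} = +1` the main term `F(−1) − F(−β₁)` may be smaller than the error (the "flat"
regime), exactly as in the printed statement [Gun–Naik 2024, Thm. 7].
References: [LagariasMontgomeryOdlyzko1979, §7]; [ThornerZaman2019, §§4–5]; G. Hoheisel (1930); A. Balog, K. Ono,
J. Number Theory 91 (2001) 356–371; S. Gun, S. L. Naik, arXiv:2405.04698 (2024), Thm. 7.
-/

noncomputable section

open Complex Real MeasureTheory Set Filter Topology NumberField NumberField.InfinitePlace IsDedekindDomain
open scoped NumberField nonZeroDivisors

namespace Summit.QuantumAdvantage.QuantumAdvantage.Theorems.DegreeOnePrimesEscape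

open Literature.NumberTheory.LFunctions Literature.NumberTheory.LFunctions.NumberField
  Literature.NumberTheory.LFunctions.EntireEF Literature.NumberTheory.LFunctions.WindowWeight
  Literature.NumberTheory.LFunctions.AbelianDensity

/-- Real-arithmetic glue: `m(B + J) ≤ κ x η` from `B + h J ≤ x η (9κ₁/2 + κ₂)`, `h ≥ 1`, `m ≤ n₀`,
`n₀ (9κ₁/2 + κ₂) = κ`. -/
theorem core_glue {m n₀ hN B J x η κ₁ κ₂ κ : ℝ} (hm0 : 0 ≤ m) (hmn : m ≤ n₀) (hh1 : 1 ≤ hN)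
    (hB : 0 ≤ B) (hJ : 0 ≤ J) (hbook : B + hN * J ≤ x * η * (9 / 2 * κ₁ + κ₂)) (hκ : n₀ * (9 / 2 * κ₁ + κ₂) = κ) :
    m * (B + J) ≤ κ * x * η := by
  have h1 : J ≤ hN * J := by nlinarith
  have h2 : B + J ≤ x * η * (9 / 2 * κ₁ + κ₂) := by linarith
  have h3 : 0 ≤ B + J := by positivity
  calc m * (B + J) ≤ n₀ * (B + J) := mul_le_mul_of_nonneg_right hmn h3
    _ ≤ n₀ * (x * η * (9 / 2 * κ₁ + κ₂)) := mul_le_mul_of_nonneg_left h2 (hm0.trans hmn)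
    _ = κ * x * η := by rw [← hκ]; ring

set_option maxHeartbeats 3200000 in
/-- **The Deuring-twisted window explicit formula of a cyclic `N|E`: the dichotomy** (see the module docstring).
[cite: LagariasMontgomeryOdlyzko1979, §7] [cite: ThornerZaman2019, §5] -/
theorem frobWindow_dichotomy (n₀ : ℕ) (hn₀ : 1 < n₀) {b D a : ℝ} (hb : 0 < b) (hD : 0 < D) (ha : 1 ≤ a)
    {κ : ℝ} (hκ : 0 < κ) {ε₀ : ℝ} (hε₀ : 0 < ε₀) (hε₀1 : ε₀ ≤ 1 / 4) :
    ∃ θ a₁ c : ℝ, 0 < θ ∧ θ ≤ 1 / 8 ∧ 1 ≤ a₁ ∧ 0 < c ∧ c ≤ 1 / (8 * ((n₀ : ℝ) ^ 2 + 1)) ∧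
    ∀ (E N : Type) [Field E] [NumberField E] [Field N] [NumberField N] [Algebra E N],
      Module.finrank ℚ N = n₀ →
      (∀ (T : ℝ), 1 ≤ T → ∀ u : AddChar (Additive (ClassGroup (𝓞 N))) ℂ → Finset ℂ,
        (∀ ψ, ∀ ρ ∈ u ψ, famF N ψ ρ = 0 ∧ 1 / 4 ≤ ρ.re ∧ ρ.re < 1 ∧ |ρ.im| ≤ T) →
        ∀ α : ℝ, α ≤ 1 →
          ∑ ψ, ∑ ρ ∈ u ψ with α ≤ ρ.re, (famMult N ψ ρ : ℝ) ≤
            D * Real.exp (b * (a * Real.log (ThornerZaman.condQn N) + Real.log (T + 4))) ^ (1 - α)) →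
      ∀ (m : ℕ), 1 ≤ m → Module.finrank ℚ N = Module.finrank ℚ E * m →
      ∀ (𝔣 : ℕ → Ideal (𝓞 E)) (χ : ℕ → HeightOneSpectrum (𝓞 E) → ℂ)
        (p : ℕ → Finset {w : InfinitePlace E // w.IsReal}) (L L' : ℕ → ℂ → ℂ),
      (∀ j, 𝔣 j ≠ ⊥ ∧ IsRayClassCharacter (𝔣 j) (χ j) ∧ IsPrimitive (𝔣 j) (χ j) ∧ IsSignType (𝔣 j) (χ j) (p j)) →
      (∀ j ∈ Finset.Ico 1 m, ∃ v : HeightOneSpectrum (𝓞 E), ¬ 𝔣 j ≤ v.asIdeal ∧ χ j v ≠ 1) →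
      (∀ j ∈ Finset.Ico 1 m, Differentiable ℂ (L j) ∧ ∀ s : ℂ, 1 < s.re → L j s = rayClassLSeries (𝔣 j) (χ j) s) →
      (∀ j ∈ Finset.Ico 1 m, Differentiable ℂ (L' j) ∧
        ∀ s : ℂ, 1 < s.re → L' j s = rayClassLSeries (𝔣 j) (star (χ j)) s) →
      (∀ ρ : ℂ, analyticOrderNatAt (dedekindZeta₁ N) ρ =
        analyticOrderNatAt (dedekindZeta₁ E) ρ + ∑ j ∈ Finset.Ico 1 m, analyticOrderNatAt (L j) ρ) →
      𝔣 0 = ⊤ → (∀ v, χ 0 v = 1) →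
      (∀ j ∈ Finset.Ico 1 m, |(NumberField.discr E : ℝ)| * (Ideal.absNorm (𝔣 j) : ℝ) ≤ (NumberField.discr N).natAbs) →
      ((NumberField.discr E).natAbs : ℝ) ≤ (NumberField.discr N).natAbs →
      ∀ x η : ℝ, ThornerZaman.condQn N ^ a₁ ≤ x → 0 < η → η ≤ Real.log 2 →
        Real.exp (-(θ / 8) * Real.log x) ≤ 2 * η →
      ∀ lo hi : ℝ, Real.log x ≤ lo → lo < hi → hi ≤ Real.log x + η →
      (∀ (cc : ℂ), ‖cc‖ ≤ 1 →
          (¬ ∃ β₁ : ℝ, dedekindZeta₁ N β₁ = 0 ∧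
            1 - c / (Real.log ((NumberField.discr N).natAbs : ℝ) + Real.log 4) < β₁ ∧ β₁ < 1) →
          ‖∑ j ∈ Finset.range m, cc ^ j * coefFordK (rcCoef (𝔣 j) (χ j)) (windowTest lo hi (ε₀ * η)) 0 -
              fordLaplace (windowTest lo hi (ε₀ * η)) (-1)‖ ≤ κ * x * η) ∧
      (∀ β₁ : ℝ, dedekindZeta₁ N β₁ = 0 →
          1 - c / (Real.log ((NumberField.discr N).natAbs : ℝ) + Real.log 4) < β₁ → β₁ < 1 →
        ∃ j₀ : ℕ, j₀ < m ∧
          ((j₀ = 0 ∧ analyticOrderNatAt (dedekindZeta₁ E) β₁ = 1) ∨ (0 < j₀ ∧ analyticOrderNatAt (L j₀) β₁ = 1)) ∧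
          ∀ (cc : ℂ), ‖cc‖ ≤ 1 →
            ‖∑ j ∈ Finset.range m, cc ^ j * coefFordK (rcCoef (𝔣 j) (χ j)) (windowTest lo hi (ε₀ * η)) 0 -
                fordLaplace (windowTest lo hi (ε₀ * η)) (-1) +
                cc ^ j₀ * fordLaplace (windowTest lo hi (ε₀ * η)) (-(β₁ : ℂ))‖ ≤ κ * x * η) := by
  classical
  -- absolute data
  obtain ⟨c₀, hc₀, hpackAll⟩ := exists_exceptionalZero_const n₀
  obtain ⟨Al, hAl0, hAl⟩ := exists_norm_logDeriv_classGroupLFunction_left_le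
  obtain ⟨Cr, hCr0, hCr⟩ := exists_norm_logDeriv_continuation_left_le
  obtain ⟨M, hM1, hM⟩ := TZWeight.exists_smoothTransition_deriv_bound
  obtain ⟨hc₁16, hc₂0⟩ := tailConst_nonneg
  have hlC := leftLineConst_nonneg
  have hn2 : (2 : ℝ) ≤ n₀ := by exact_mod_cast hn₀
  have hn0 : (0 : ℝ) < n₀ := by linarith
  have hM0 : 0 ≤ M := by linarith
  have hAC0 : 0 < max Al Cr := lt_max_of_lt_left hAl0
  -- the window constant
  set c : ℝ := min c₀ (1 / (8 * ((n₀ : ℝ) ^ 2 + 1))) with hcdef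
  have hc : 0 < c := lt_min hc₀ (by positivity)
  have hcc₀ : c ≤ c₀ := min_le_left _ _
  have hcn : c ≤ 1 / (8 * ((n₀ : ℝ) ^ 2 + 1)) := min_le_right _ _
  -- precision targets
  set κ₁ : ℝ := κ / (9 * n₀) with hκ₁
  set κ₂ : ℝ := κ / (2 * n₀) with hκ₂
  have hκ₁0 : 0 < κ₁ := by positivity
  have hκ₂0 : 0 < κ₂ := by positivity
  have hκsum : (n₀ : ℝ) * (9 / 2 * κ₁ + κ₂) = κ := by rw [hκ₁, hκ₂]; field_simp; ring
  -- the exponent `θ`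
  set Λ : ℝ := Real.log (2 * Real.exp 1 * D / κ₁ + 3) with hΛ
  have hΛarg : 1 < 2 * Real.exp 1 * D / κ₁ + 3 := by
    have : 0 < 2 * Real.exp 1 * D / κ₁ := by positivity
    linarith
  have hΛ0 : 0 < Λ := Real.log_pos hΛarg
  set θ : ℝ := min (1 / (8 * b)) (min (1 / 8) (c / (6 * Λ))) with hθ
  have hθ0 : 0 < θ := by positivity
  have hθb : θ * b ≤ 1 / 8 := by
    have h1 : θ ≤ 1 / (8 * b) := min_le_left _ _
    calc θ * b ≤ 1 / (8 * b) * b := mul_le_mul_of_nonneg_right h1 hb.le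
      _ = 1 / 8 := by field_simp
  have hθ1 : θ ≤ 1 / 8 := (min_le_right _ _).trans (min_le_left _ _)
  have hθΛ : θ ≤ c / (6 * Λ) := (min_le_right _ _).trans (min_le_right _ _)
  have hθflat : 2 * Real.exp 1 * D * Real.exp (-(c / (6 * θ))) ≤ κ₁ := by
    have h1 : Λ ≤ c / (6 * θ) := by
      rw [le_div_iff₀ (by positivity)]
      have := (le_div_iff₀ (by positivity : (0 : ℝ) < 6 * Λ)).1 hθΛ
      linarith
    have h2 : Real.exp (-(c / (6 * θ))) ≤ Real.exp (-Λ) := Real.exp_le_exp.2 (by linarith)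
    have h3 : Real.exp (-Λ) = (2 * Real.exp 1 * D / κ₁ + 3)⁻¹ := by
      rw [hΛ, Real.exp_neg, Real.exp_log (by linarith)]
    have h4 : 2 * Real.exp 1 * D * (2 * Real.exp 1 * D / κ₁ + 3)⁻¹ ≤ κ₁ := by
      rw [← div_eq_mul_inv, div_le_iff₀ (by linarith)]
      have : κ₁ * (2 * Real.exp 1 * D / κ₁ + 3) = 2 * Real.exp 1 * D + 3 * κ₁ := by field_simp
      rw [this]; linarith
    calc 2 * Real.exp 1 * D * Real.exp (-(c / (6 * θ))) ≤ 2 * Real.exp 1 * D * Real.exp (-Λ) :=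
          mul_le_mul_of_nonneg_left h2 (by positivity)
      _ ≤ κ₁ := by rw [h3]; exact h4
  -- the absorption constant and the threshold
  set W₀ : ℝ := 512 * ((n₀ : ℝ) + 1) with hW₀
  have hW₀0 : 0 < W₀ := by positivity
  set CJ : ℝ := 338 * W₀ + 96 * (M / (4 * ε₀)) * W₀ * (4 * tailConst₁ + tailConst₂) + 108 +
    640 * leftLineConst * (max Al Cr) * (M / (4 * ε₀)) with hCJ
  have hc₁0 : 0 ≤ tailConst₁ := by linarith
  have hCJ0 : 0 ≤ CJ := by rw [hCJ]; positivity
  obtain ⟨a₁', ha₁'1, habsAll⟩ := absorb_junk (CJ / κ₂) θ (by positivity) hθ0 (by linarith)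
  set a₁ : ℝ := max a₁' (a / θ) with ha₁
  have ha₁1 : 1 ≤ a₁ := ha₁'1.trans (le_max_left _ _)
  refine ⟨θ, a₁, c, hθ0, hθ1, ha₁1, hc, hcn, ?_⟩
  intro E N _ _ _ _ _ hNn hdens m hm1 hdeg 𝔣 χ p L L' hdata hnt hL hL' hord h𝔣0 hχ0 hcond hdE x η hx hη0 hη1 hηx
    lo hi hlo hlohi hhi
  -- sizes
  have hN : 1 < Module.finrank ℚ N := by rw [hNn]; exact hn₀
  have hQ12 : (12 : ℝ) ≤ ThornerZaman.condQn N := ThornerZaman.twelve_le_condQn (K := N) hN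
  have hQ1 : (1 : ℝ) < ThornerZaman.condQn N := by linarith
  have hQ0 : (0 : ℝ) < ThornerZaman.condQn N := by linarith
  obtain ⟨-, -, hlog12⟩ := log_small_consts
  have hlogQ : 2 ≤ Real.log (ThornerZaman.condQn N) := hlog12.trans (Real.log_le_log (by norm_num) hQ12)
  have hmn₀ : (m : ℝ) ≤ n₀ := by
    have : m ≤ n₀ := by rw [← hNn, hdeg]; exact Nat.le_mul_of_pos_left m Module.finrank_pos
    exact_mod_cast this
  have hm0 : (0 : ℝ) ≤ m := Nat.cast_nonneg _
  have hnEn₀ : (Module.finrank ℚ E : ℝ) ≤ n₀ := by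
    have : Module.finrank ℚ E ≤ n₀ := by rw [← hNn, hdeg]; exact Nat.le_mul_of_pos_right _ hm1
    exact_mod_cast this
  have hxa₁' : ThornerZaman.condQn N ^ a₁' ≤ x :=
    (Real.rpow_le_rpow_of_exponent_le hQ1.le (le_max_left _ _)).trans hx
  have hxaθ : ThornerZaman.condQn N ^ (a / θ) ≤ x :=
    (Real.rpow_le_rpow_of_exponent_le hQ1.le (le_max_right _ _)).trans hx
  have hQx : ThornerZaman.condQn N ≤ x := by
    have := (Real.rpow_le_rpow_of_exponent_le hQ1.le ha₁1).trans hx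
    rwa [Real.rpow_one] at this
  have hx1 : 1 < x := by linarith
  have hx0 : 0 < x := by linarith
  have hL0 : 0 < Real.log x := Real.log_pos hx1
  have hxexp : Real.exp (Real.log x) = x := Real.exp_log hx0
  have haθ : a * Real.log (ThornerZaman.condQn N) ≤ θ * Real.log x := by
    have h1 := Real.log_le_log (by positivity) hxaθ
    rw [Real.log_rpow (by linarith)] at h1
    have h2 : θ * (a / θ * Real.log (ThornerZaman.condQn N)) = a * Real.log (ThornerZaman.condQn N) := by
      field_simp
    have h3 := mul_le_mul_of_nonneg_left h1 hθ0.le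
    linarith
  have h2θ : 2 ≤ θ * Real.log x := by
    have := mul_le_mul ha hlogQ (by norm_num) (by linarith : (0 : ℝ) ≤ a)
    linarith
  have habs : (338 * W₀ + 96 * (M / (4 * ε₀)) * W₀ * (4 * tailConst₁ + tailConst₂) + 108 +
      640 * leftLineConst * (max Al Cr) * (M / (4 * ε₀))) * ThornerZaman.condQn N ^ (7 : ℕ) * (Real.log x + 1) *
      Real.exp (-(θ / 4) * Real.log x) ≤ κ₂ := by
    have h1 := habsAll (ThornerZaman.condQn N) x hQ12 hxa₁'
    rw [Real.rpow_def_of_pos hx0, show Real.log x * (-(θ / 4)) = -(θ / 4) * Real.log x by ring] at h1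
    rw [← hCJ]
    have h2 : CJ * ThornerZaman.condQn N ^ (7 : ℕ) * (Real.log x + 1) * Real.exp (-(θ / 4) * Real.log x) =
        κ₂ * (CJ / κ₂ * ThornerZaman.condQn N ^ (7 : ℕ) * (Real.log x + 1) * Real.exp (-(θ / 4) * Real.log x)) := by
      field_simp
    rw [h2]
    have := mul_le_mul_of_nonneg_left h1 hκ₂0.le
    linarith
  -- the window
  set ε : ℝ := ε₀ * η with hε
  have hε0 : 0 < ε := by positivity
  have hε4 : ε ≤ η / 4 := by
    rw [hε]; have := mul_le_mul_of_nonneg_right hε₀1 hη0.le; linarith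
  have hθL8 : θ * Real.log x ≤ Real.log x / 8 := by
    have := mul_le_mul_of_nonneg_right hθ1 hL0.le; linarith
  have hL16 : 16 ≤ Real.log x := by linarith
  have hlog2 : Real.log 2 < 0.6931471808 := Real.log_two_lt_d9
  have hεlo : ε < lo := by linarith
  have hLX0 : 0 ≤ hi + ε := by linarith
  have hT₁1 : 1 ≤ Real.exp (θ * (hi + ε)) := Real.one_le_exp (mul_nonneg hθ0.le hLX0)
  have hrange : Real.exp (b * (a * Real.log (ThornerZaman.condQn N) + Real.log (Real.exp (θ * (hi + ε)) + 4))) ≤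
      Real.exp (hi + ε) ^ ((1 : ℝ) / 2) :=
    frobWindow_range (LX := hi + ε) hb hθ0 hθb hθ1 haθ h2θ hlo hlohi hε0 rfl rfl
  -- sizes of the field data of `N`
  have hnQ : ((n₀ : ℕ) : ℝ) ≤ ThornerZaman.condQn N := by
    rw [← hNn]; exact ThornerZaman.finrank_le_condQn (K := N)
  have hhK : (NumberField.classNumber N : ℝ) ≤ ThornerZaman.condQn N ^ (4 : ℕ) :=
    ThornerZaman.classNumber_le_condQn_pow (K := N) hN
  have hhK1 : (1 : ℝ) ≤ NumberField.classNumber N := by exact_mod_cast one_le_classNumber (K := N)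
  have hAK4 : Real.log ((NumberField.discr N).natAbs : ℝ) + 3 * ((n₀ : ℕ) : ℝ) ≤ 4 * ThornerZaman.condQn N := by
    rw [← hNn]; exact windowConst_le_condQn N
  have hlogd0 : 0 ≤ Real.log ((NumberField.discr N).natAbs : ℝ) := Real.log_natCast_nonneg _
  have hlog4 : 0 ≤ Real.log 4 := Real.log_nonneg (by norm_num)
  -- the bookkeeping bound, in the shape of `frobWindow_core`
  have hbook := frobWindow_bookkeeping (W₀ := 512 * (((n₀ : ℕ) : ℝ) + 1)) (A_L := max Al Cr)
    (AK := Real.log ((NumberField.discr N).natAbs : ℝ) + 3 * ((n₀ : ℕ) : ℝ))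
    (hK := (NumberField.classNumber N : ℝ)) (κ₁ := κ₁) (κ₂ := κ₂) (L := Real.log x)
    (ℓ := hi - lo + 2 * ε) (LX := hi + ε) (X := Real.exp (hi + ε)) (T₁ := Real.exp (θ * (hi + ε)))
    hQ12 hM1 hAC0 (by positivity) hlC hc₁16 hc₂0 hD hc ha hhK (Nat.cast_nonneg _) rfl hAK4 hlogd0 hnQ
    (Nat.cast_nonneg _) hθ0 hθ1 hθflat haθ h2θ hη0 hη1 hηx hε₀ hε₀1 (by rw [← hW₀]; exact habs) hlo hlohi hhi
    hε rfl rfl rfl rfl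
  rw [hxexp] at hbook
  -- the Landau–Page package of `N`
  obtain ⟨hLPreal, hLPuniq, hLPsimple⟩ := hpackAll N hNn
  have hpack_c := pack_of_le (K := N) hcc₀ hLPreal
  have hexcZ : ∀ ρ, dedekindZeta₁ N ρ = 0 → excRegion c N ρ →
      (((1 : ClassGroup (𝓞 N) →* ℂˣ) = 1 → dedekindZeta₁ N ρ = 0) ∧
        ((1 : ClassGroup (𝓞 N) →* ℂˣ) ≠ 1 → classGroupLFunction₀ N 1 ρ = 0)) ∧
        1 - c₀ / (Real.log ((NumberField.discr N).natAbs : ℝ) + Real.log (|ρ.im| + 4)) < ρ.re := fun ρ h0 hexc ↦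
    ⟨⟨fun _ ↦ h0, fun h ↦ absurd rfl h⟩, lpRegion_mono hcc₀ (by rw [hexc.1, abs_zero, zero_add]; exact hexc.2)⟩
  -- the core estimate, as a function of the exceptional sets
  have hcore : ∀ (cc : ℂ), ‖cc‖ ≤ 1 → ∀ (Exc : ℕ → Finset ℂ),
      (∀ ρ ∈ Exc 0, famF E 0 ρ = 0 ∧ 0 < ρ.re ∧ ρ.re < 1) →
      (∀ j ∈ Finset.Ico 1 m, ∀ ρ ∈ Exc j, L j ρ = 0 ∧ 0 < ρ.re ∧ ρ.re < 1) →
      (∀ ρ, dedekindZeta₁ N ρ = 0 → 0 < ρ.re → ρ.re < 1 → excRegion c N ρ →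
        (famF E 0 ρ = 0 → ρ ∈ Exc 0) ∧ ∀ j ∈ Finset.Ico 1 m, L j ρ = 0 → ρ ∈ Exc j) →
      ‖∑ j ∈ Finset.range m, cc ^ j * coefFordK (rcCoef (𝔣 j) (χ j)) (windowTest lo hi ε) 0 -
          fordLaplace (windowTest lo hi ε) (-1) +
          (∑ ρ ∈ Exc 0, (famMult E 0 ρ : ℂ) * fordLaplace (windowTest lo hi ε) (-ρ) +
            ∑ j ∈ Finset.Ico 1 m, cc ^ j *
              ∑ ρ ∈ Exc j, (analyticOrderNatAt (L j) ρ : ℂ) * fordLaplace (windowTest lo hi ε) (-ρ))‖ ≤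
        κ * x * η := by
    intro cc hcc Exc hExc0 hExcj hExc'
    have h := frobWindow_core n₀ hn₀ hb hD ha hc hAl0 hAl hCr0 hCr hM E N hNn hdens hpack_c m hm1 𝔣 χ p L L' hdata
      hnt hL hL' hord h𝔣0 hχ0 hcond hdE hnEn₀ hε0 hεlo hlohi hT₁1 hrange cc hcc Exc hExc0 hExcj hExc'
    rw [hNn] at h
    have hℓ0 : 0 ≤ hi - lo + 2 * ε := by linarith
    refine h.trans (core_glue hm0 hmn₀ hhK1 ?_ ?_ hbook hκsum)
    · refine mul_nonneg (Real.exp_pos _).le (add_nonneg (add_nonneg ?_ ?_) ?_)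
      · exact mul_nonneg hℓ0 (by positivity)
      · have h5 : 0 ≤ Real.log (Real.exp (θ * (hi + ε)) + 5) :=
          Real.log_nonneg (by linarith [Real.exp_pos (θ * (hi + ε))])
        have hAK0 : 0 ≤ Real.log ((NumberField.discr N).natAbs : ℝ) + 3 * ((n₀ : ℕ) : ℝ) := by positivity
        exact mul_nonneg (mul_nonneg hℓ0 (by positivity)) (mul_nonneg (by positivity)
          (mul_nonneg (by positivity) (mul_nonneg (by positivity) (add_nonneg hAK0 h5))))
      · positivity
    · exact add_nonneg (mul_nonneg (by positivity) hℓ0) (by positivity)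
  clear hbook habs habsAll
  -- THE DICHOTOMY
  refine ⟨fun cc hcc hnoexc ↦ ?_, fun β₁ hζβ hβwin hβ1 ↦ ?_⟩
  · -- (A) no exceptional zero of `ζ₁_N`
    have hex : ¬ ∃ ρ : ℂ, dedekindZeta₁ N ρ = 0 ∧ 0 < ρ.re ∧ ρ.re < 1 ∧ excRegion c N ρ := by
      rintro ⟨ρ, h0, h1, h2, hexc⟩
      obtain ⟨him, -⟩ := hLPreal 1 ρ (hexcZ ρ h0 hexc)
      have hρ : ρ = (ρ.re : ℂ) := by apply Complex.ext <;> simp [him]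
      exact hnoexc ⟨ρ.re, by rw [← hρ]; exact h0, hexc.2, h2⟩
    have key := hcore cc hcc (fun _ ↦ ∅) (fun ρ hρ ↦ by simp at hρ) (fun j _ ρ hρ ↦ by simp at hρ)
      (fun ρ h0 h1 h2 hexc ↦ absurd ⟨ρ, h0, h1, h2, hexc⟩ hex)
    simp only [Finset.sum_empty, mul_zero, Finset.sum_const_zero, add_zero] at key
    exact key
  · -- (B) an exceptional zero `β₁` of `ζ₁_N`: real, unique, simple
    have hZ₁ : (((1 : ClassGroup (𝓞 N) →* ℂˣ) = 1 → dedekindZeta₁ N β₁ = 0) ∧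
        ((1 : ClassGroup (𝓞 N) →* ℂˣ) ≠ 1 → classGroupLFunction₀ N 1 β₁ = 0)) ∧
        1 - c₀ / (Real.log ((NumberField.discr N).natAbs : ℝ) + Real.log (|(β₁ : ℂ).im| + 4)) < (β₁ : ℂ).re := by
      refine ⟨⟨fun _ ↦ hζβ, fun h ↦ absurd rfl h⟩, lpRegion_mono hcc₀ ?_⟩
      rw [Complex.ofReal_im, abs_zero, zero_add, Complex.ofReal_re]; exact hβwin
    have hmult : analyticOrderNatAt (dedekindZeta₁ N) β₁ = 1 := by
      obtain ⟨hs1, -⟩ := hLPsimple 1 (β₁ : ℂ) hZ₁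
      have h := hs1 rfl
      have hne : analyticOrderAt (dedekindZeta₁ N) β₁ ≠ ⊤ := by rw [h]; exact ENat.one_ne_top
      have : (analyticOrderNatAt (dedekindZeta₁ N) β₁ : ℕ∞) = 1 := by rw [Nat.cast_analyticOrderNatAt hne, h]
      exact_mod_cast this
    have hβhalf : 1 / 2 ≤ β₁ := by
      have hlog4' : 1 < Real.log 4 := by
        rw [show (4:ℝ) = 2 ^ 2 by norm_num, Real.log_pow]; have := Real.log_two_gt_d9; push_cast; linarith
      have hc2 : c ≤ 1 / 2 := by
        refine hcn.trans ?_
        rw [div_le_div_iff_of_pos_left one_pos (by positivity) (by norm_num)]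
        have : (0 : ℝ) ≤ (n₀ : ℝ) ^ 2 := sq_nonneg _
        linarith
      have hden : 1 ≤ Real.log ((NumberField.discr N).natAbs : ℝ) + Real.log 4 := by linarith
      have : c / (Real.log ((NumberField.discr N).natAbs : ℝ) + Real.log 4) ≤ 1 / 2 := by
        rw [div_le_iff₀ (by linarith)]
        have := mul_le_mul hc2 hden zero_le_one (by norm_num)
        linarith
      linarith
    have hβ0 : 0 < β₁ := by linarith
    -- the index `j₀` carrying `β₁`
    have hsum1 : analyticOrderNatAt (dedekindZeta₁ E) β₁ + ∑ j ∈ Finset.Ico 1 m, analyticOrderNatAt (L j) β₁ = 1 := by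
      rw [← hord]; exact hmult
    -- the exceptional sets
    set Exc : ℕ → Finset ℂ := fun j ↦
      if j = 0 then (if dedekindZeta₁ E β₁ = 0 then {(β₁ : ℂ)} else ∅)
      else (if L j β₁ = 0 then {(β₁ : ℂ)} else ∅) with hExcdef
    have hExc0 : ∀ ρ ∈ Exc 0, famF E 0 ρ = 0 ∧ 0 < ρ.re ∧ ρ.re < 1 := by
      intro ρ hρ
      rw [hExcdef] at hρ; dsimp only at hρ; rw [if_pos rfl] at hρ
      split_ifs at hρ with h0
      · rw [Finset.mem_singleton] at hρ; subst hρ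
        exact ⟨by rw [famF_zero]; exact h0, by rw [Complex.ofReal_re]; exact hβ0, by rw [Complex.ofReal_re]; exact hβ1⟩
      · simp at hρ
    have hExcj : ∀ j ∈ Finset.Ico 1 m, ∀ ρ ∈ Exc j, L j ρ = 0 ∧ 0 < ρ.re ∧ ρ.re < 1 := by
      intro j hj ρ hρ
      have hj0 : j ≠ 0 := by rw [Finset.mem_Ico] at hj; omega
      rw [hExcdef] at hρ; dsimp only at hρ; rw [if_neg hj0] at hρ
      split_ifs at hρ with h0
      · rw [Finset.mem_singleton] at hρ; subst hρ
        exact ⟨h0, by rw [Complex.ofReal_re]; exact hβ0, by rw [Complex.ofReal_re]; exact hβ1⟩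
      · simp at hρ
    have hExc' : ∀ ρ, dedekindZeta₁ N ρ = 0 → 0 < ρ.re → ρ.re < 1 → excRegion c N ρ →
        (famF E 0 ρ = 0 → ρ ∈ Exc 0) ∧ ∀ j ∈ Finset.Ico 1 m, L j ρ = 0 → ρ ∈ Exc j := by
      intro ρ h0 _ _ hexc
      obtain ⟨-, hρρ⟩ := hLPuniq 1 1 ρ (β₁ : ℂ) (hexcZ ρ h0 hexc) hZ₁
      subst hρρ
      refine ⟨fun hE0 ↦ ?_, fun j hj hj0 ↦ ?_⟩
      · rw [famF_zero] at hE0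
        rw [hExcdef]; dsimp only; rw [if_pos rfl, if_pos hE0, Finset.mem_singleton]
      · have hjne : j ≠ 0 := by rw [Finset.mem_Ico] at hj; omega
        rw [hExcdef]; dsimp only; rw [if_neg hjne, if_pos hj0, Finset.mem_singleton]
    -- the correction term is `(Σ_j c^j ord_j(β₁)) F(−β₁)`
    have hcorr : ∀ (cc : ℂ) (gg : ℝ → ℝ),
        ∑ ρ ∈ Exc 0, (famMult E 0 ρ : ℂ) * fordLaplace gg (-ρ) +
          ∑ j ∈ Finset.Ico 1 m, cc ^ j * ∑ ρ ∈ Exc j, (analyticOrderNatAt (L j) ρ : ℂ) * fordLaplace gg (-ρ) =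
        ((analyticOrderNatAt (dedekindZeta₁ E) β₁ : ℂ) +
          ∑ j ∈ Finset.Ico 1 m, cc ^ j * (analyticOrderNatAt (L j) β₁ : ℂ)) * fordLaplace gg (-(β₁ : ℂ)) := by
      intro cc gg
      have h0 : ∑ ρ ∈ Exc 0, (famMult E 0 ρ : ℂ) * fordLaplace gg (-ρ) =
          (analyticOrderNatAt (dedekindZeta₁ E) β₁ : ℂ) * fordLaplace gg (-(β₁ : ℂ)) := by
        rw [hExcdef]; dsimp only; rw [if_pos rfl]; simp only [famMult, famF_zero]
        exact sum_excSingleton_eq (dedekindZeta₁_differentiable E) (β₁ : ℂ) (fun ρ ↦ fordLaplace gg (-ρ))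
      have hj : ∀ j ∈ Finset.Ico 1 m, ∑ ρ ∈ Exc j, (analyticOrderNatAt (L j) ρ : ℂ) * fordLaplace gg (-ρ) =
          (analyticOrderNatAt (L j) β₁ : ℂ) * fordLaplace gg (-(β₁ : ℂ)) := by
        intro j hj
        have hjne : j ≠ 0 := by rw [Finset.mem_Ico] at hj; omega
        rw [hExcdef]; dsimp only; rw [if_neg hjne]
        exact sum_excSingleton_eq (hL j hj).1 (β₁ : ℂ) (fun ρ ↦ fordLaplace gg (-ρ))
      rw [h0, Finset.sum_congr rfl (fun j hj' ↦ by rw [hj j hj']), add_mul, Finset.sum_mul]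
      refine congrArg _ (Finset.sum_congr rfl fun j _ ↦ by ring)
    obtain ⟨j₀, hj₀m, hj₀carrier, hθcc⟩ := exists_carrier_index (o := fun j ↦ analyticOrderNatAt (L j) β₁) hm1 hsum1
    refine ⟨j₀, hj₀m, hj₀carrier, fun cc hcc ↦ ?_⟩
    have hcorr' : ∑ ρ ∈ Exc 0, (famMult E 0 ρ : ℂ) * fordLaplace (windowTest lo hi ε) (-ρ) +
        ∑ j ∈ Finset.Ico 1 m, cc ^ j *
          ∑ ρ ∈ Exc j, (analyticOrderNatAt (L j) ρ : ℂ) * fordLaplace (windowTest lo hi ε) (-ρ) =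
        cc ^ j₀ * fordLaplace (windowTest lo hi ε) (-(β₁ : ℂ)) := by
      rw [hcorr cc, hθcc cc]
    have key := hcore cc hcc Exc hExc0 hExcj hExc'
    rw [hcorr'] at key
    exact key

end Summit.QuantumAdvantage.QuantumAdvantage.Theorems.DegreeOnePrimesEscape

end
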